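import Mathlib
import HarnessLib
import Summits.HubbardSuperconductivity.HubbardSuperconductivity.Theorems.KLProgrammePerturbedFermiCurveCausticWindow
import Summits.HubbardSuperconductivity.HubbardSuperconductivity.Theorems.KLProgrammeKLRegimeTwoPointLimitShellCountTools

/-!
# Route `KLProgramme` — ENGINE child (stmt-HubbardSuperconductivity-20437 `KLRegimeEngineV17F2`): zeros of the translated level on CAUSTIC WINDOWS of the
# frame's Fermi curve (step (T2)-caustic; design note HOME/hubbard-kl-k3c2-p2/TWO-SHELL-FRAME-PORT.md §6–§8)

Cell `gate-hubbard-kl`, seat hubbard-kl-k3c2-p2 g15.  Frame twins of p1b's `klsd_window_zeros_card_le_two` / `klsd_nearCaustic_zeros_card_le_six` over the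
generic tools `klsk_*`, with the window geometry of `…CausticWindow` (`exists_int_near_of_close_frame`, `abs_curve_sub_le_frame`) and the uniform window
convexity as hypothesis `hcwin` (discharged by `transCurve_second_deriv_ge_on_window`):
* `int_mem_quad_of_abs_sub_lt_two` — integers within `< 2` of `t` (the caustic translates in reach);
* `abs_transCurve_deriv_le` — `|G′| ≤ Kc·√2 S_E`;
* `window_zeros_card_le_two_frame` — on a `c`-convex window `G(θ) = E(p(θ) − v) − ν` has at most two zeros;
* `nearCaustic_zeros_card_le_six_frame` — per caustic translate `2πm`, the zeros of a period with `2p − v` within `ρ₂` of `2πm` number `≤ 6`.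
The count away from the Cooper point is assembled in `…CausticCount`.
Everything is PROVED; no definitions, no named facts; nothing asserts any stub or superconductivity.
References: DECOMP App. E Lemma E.3; FST II App. B [cite: FeldmanSalmhoferTrubowitz1998]; BGM 2006 §2.7 [cite: BenfattoGiulianiMastropietro2006].
-/

noncomputable section

namespace Summit.HubbardSuperconductivity.HubbardSuperconductivity.Theorems.PerturbedFermiCurve

set_option linter.dupNamespace false -- summit = problem name (single-conjunct summit), D-0017

open Real Set MeasureTheory
open Literature.MathematicalPhysics.QuantumLattice Literature.MathematicalPhysics.QuantumLattice.BandSectorCounting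
open Literature.MathematicalPhysics.QuantumLattice.FermiRG
open Summit.HubbardSuperconductivity.HubbardSuperconductivity.Theorems.DispersionFlow
open Summit.HubbardSuperconductivity.HubbardSuperconductivity.Theorems.KLRegimeSplit

/-- Integers within `< 2` of a real `t` are among `⌊t⌋ − 1, ⌊t⌋, ⌊t⌋ + 1, ⌊t⌋ + 2`. [folklore] -/
theorem int_mem_quad_of_abs_sub_lt_two {t : ℝ} {n : ℤ} (h : |t - n| < 2) :
    n ∈ ({⌊t⌋ - 1, ⌊t⌋, ⌊t⌋ + 1, ⌊t⌋ + 2} : Finset ℤ) := by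
  rw [abs_lt] at h
  have h1 := Int.floor_le t
  have h2 := Int.lt_floor_add_one t
  have hlo : ⌊t⌋ - 1 ≤ n := by
    have : (⌊t⌋ : ℝ) - 2 < n := by linarith
    have : ⌊t⌋ - 2 < n := by exact_mod_cast this
    omega
  have hhi : n ≤ ⌊t⌋ + 2 := by
    have : (n : ℝ) < ⌊t⌋ + 3 := by linarith
    have : n < ⌊t⌋ + 3 := by exact_mod_cast this
    omega
  simp only [Finset.mem_insert, Finset.mem_singleton]
  omega

section Root

variable {a b : ℝ} (B : BandBounds a b) {K : TrigPolyC4v} {κ₀ κ₁ ν : ℝ}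
  (hδ : ∀ k : Fin 2 → ℝ, (∀ i, |k i| ≤ π) → |(fun k : Fin 2 → ℝ => -K.eval k) k| ≤ κ₀) (hlo : a ≤ ν - κ₀) (hhi : ν + κ₀ ≤ b)
  (hκ : ∀ k : Fin 2 → ℝ, (∀ i, |k i| ≤ π) → ‖fderiv ℝ (fun k : Fin 2 → ℝ => -K.eval k) k‖ ≤ κ₁) (hκ₁ : κ₁ < B.Dtmin)
  {u : ℝ → ℝ} (hu : ∀ θ, IsBandFermiRadius (ν - (fun k : Fin 2 → ℝ => -K.eval k) (u θ • dir θ)) θ (u θ))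
  {μ Kc r₀ g₀ w : ℝ} (hG : GeomConstants (frameLevel μ K) Kc r₀ g₀ w)
include B hδ hlo hhi hκ hκ₁ hu hG

/-- **Slope bound**: `|G′(θ)| = |De_K(Q)[V]| ≤ Kc·√2 S_E`. [folklore] -/
theorem abs_transCurve_deriv_le (θ : ℝ) (wv : Fin 2 → ℝ) :
    |fderiv ℝ (frameLevel μ K) (WithLp.toLp 2 (u θ • dir θ - wv)) (WithLp.toLp 2 ![VXE u θ, VYE u θ])| ≤
      Kc * (Real.sqrt 2 * (B.smax + κ₁ * (π * Real.sqrt 2 + 2 * B.smax) / (B.Dtmin - κ₁))) := by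
  set SE := B.smax + κ₁ * (π * Real.sqrt 2 + 2 * B.smax) / (B.Dtmin - κ₁) with hSE
  have hδs : ContDiff ℝ 2 (fun k : Fin 2 → ℝ => -K.eval k) := contDiff_frameShift_toLp K
  have h2ne : (2 : WithTop ℕ∞) ≠ 0 := by norm_num
  obtain ⟨hvx, hvy⟩ := abs_VXE_le B hδs h2ne hδ hlo hhi hκ hκ₁ hu θ
  have hKc : 0 ≤ Kc := le_trans (norm_nonneg _) (hG.norm_iteratedFDeriv_le (WithLp.toLp 2 (u θ • dir θ)) 0 (by norm_num))
  have hS2 : ‖(WithLp.toLp 2 ![VXE u θ, VYE u θ] : Momentum)‖ ^ 2 = VXE u θ ^ 2 + VYE u θ ^ 2 := by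
    rw [EuclideanSpace.norm_eq, Real.sq_sqrt (Finset.sum_nonneg fun i _ => sq_nonneg _), Fin.sum_univ_two]
    simp only [Real.norm_eq_abs, sq_abs, Matrix.cons_val_zero, Matrix.cons_val_one]
  have hSle : ‖(WithLp.toLp 2 ![VXE u θ, VYE u θ] : Momentum)‖ ≤ Real.sqrt 2 * SE := by
    have h1 : VXE u θ ^ 2 ≤ SE ^ 2 := by rw [← sq_abs]; exact pow_le_pow_left₀ (abs_nonneg _) hvx 2
    have h2 : VYE u θ ^ 2 ≤ SE ^ 2 := by rw [← sq_abs]; exact pow_le_pow_left₀ (abs_nonneg _) hvy 2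
    have hSE0 : 0 ≤ SE := (abs_nonneg _).trans hvx
    have h3 : ‖(WithLp.toLp 2 ![VXE u θ, VYE u θ] : Momentum)‖ ^ 2 ≤ (Real.sqrt 2 * SE) ^ 2 := by
      rw [hS2, mul_pow, Real.sq_sqrt (by norm_num : (0:ℝ) ≤ 2)]; linarith
    exact (pow_le_pow_iff_left₀ (norm_nonneg _) (by positivity) two_ne_zero).1 h3
  have hn : ‖fderiv ℝ (frameLevel μ K) (WithLp.toLp 2 (u θ • dir θ - wv))‖ ≤ Kc := by
    rw [← norm_iteratedFDeriv_one (𝕜 := ℝ)]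
    exact hG.norm_iteratedFDeriv_le _ 1 (by norm_num)
  rw [← Real.norm_eq_abs]
  calc ‖fderiv ℝ (frameLevel μ K) (WithLp.toLp 2 (u θ • dir θ - wv)) (WithLp.toLp 2 ![VXE u θ, VYE u θ])‖
      ≤ ‖fderiv ℝ (frameLevel μ K) (WithLp.toLp 2 (u θ • dir θ - wv))‖ * ‖(WithLp.toLp 2 ![VXE u θ, VYE u θ] : Momentum)‖ :=
        ContinuousLinearMap.le_opNorm _ _
    _ ≤ Kc * (Real.sqrt 2 * SE) := mul_le_mul hn hSle (norm_nonneg _) hKc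

omit hG in
/-- **Two zeros per convex window**: if `G″ ≥ c > 0` on `[x, y]` then `G(θ) = E(p(θ) − v) − ν` has at most two zeros there. [folklore] -/
theorem window_zeros_card_le_two_frame {x y c : ℝ} (wv : Fin 2 → ℝ) (hc : 0 < c)
    (hconv : ∀ t ∈ Icc x y, c ≤
      fderiv ℝ (fderiv ℝ (frameLevel μ K)) (WithLp.toLp 2 (u t • dir t - wv)) (WithLp.toLp 2 ![VXE u t, VYE u t])
          (WithLp.toLp 2 ![VXE u t, VYE u t]) +
        fderiv ℝ (frameLevel μ K) (WithLp.toLp 2 (u t • dir t - wv))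
          (WithLp.toLp 2 ![deriv (deriv u) t * Real.cos t - 2 * deriv u t * Real.sin t - u t * Real.cos t,
            deriv (deriv u) t * Real.sin t + 2 * deriv u t * Real.cos t - u t * Real.sin t])) :
    ∃ Z : Finset ℝ, Z.card ≤ 2 ∧
      ∀ z ∈ Icc x y, sqDispersion (u z • dir z - wv) + -K.eval (u z • dir z - wv) = ν → z ∈ Z := by
  set f := frameLevel μ K with hf
  set G : ℝ → ℝ := fun z => sqDispersion (u z • dir z - wv) + -K.eval (u z • dir z - wv) - ν with hGdef
  set G' : ℝ → ℝ := fun z => fderiv ℝ f (WithLp.toLp 2 (u z • dir z - wv)) (WithLp.toLp 2 ![VXE u z, VYE u z]) with hG'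
  set G'' : ℝ → ℝ := fun z => fderiv ℝ (fderiv ℝ f) (WithLp.toLp 2 (u z • dir z - wv)) (WithLp.toLp 2 ![VXE u z, VYE u z])
      (WithLp.toLp 2 ![VXE u z, VYE u z]) +
    fderiv ℝ f (WithLp.toLp 2 (u z • dir z - wv))
      (WithLp.toLp 2 ![deriv (deriv u) z * Real.cos z - 2 * deriv u z * Real.sin z - u z * Real.cos z,
        deriv (deriv u) z * Real.sin z + 2 * deriv u z * Real.cos z - u z * Real.sin z]) with hG''
  have hδs : ContDiff ℝ 2 (fun k : Fin 2 → ℝ => -K.eval k) := contDiff_frameShift_toLp K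
  have h2ne : (2 : WithTop ℕ∞) ≠ 0 := by norm_num
  have hu2 : ContDiff ℝ 2 u := contDiff_of_isRoot B hδs h2ne hδ hlo hhi hκ hκ₁ hu
  have hud : ∀ z, DifferentiableAt ℝ u z := fun z => (hu2.differentiable h2ne) z
  have hud' : ∀ z, DifferentiableAt ℝ (deriv u) z := fun z => by
    have h2 : ContDiff ℝ ((1 : WithTop ℕ∞) + 1) u := by rw [one_add_one_eq_two]; exact hu2
    have h : ContDiff ℝ 1 (deriv u) := (contDiff_succ_iff_deriv.1 h2).2.2
    exact (h.differentiable one_ne_zero) z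
  have hGfun : G = fun z => f (WithLp.toLp 2 (u z • dir z - wv)) + (μ - ν) := by
    funext z
    simp only [hGdef, hf, frameLevel_toLp, frameShift_toLp]
    ring
  have hGd : ∀ t, HasDerivAt G (G' t) t := fun t => by
    rw [hGfun]
    exact (hasDerivAt_frameLevel_transCurve μ K (hud t) wv).add_const (μ - ν)
  have hG'd : ∀ t, HasDerivAt G' (G'' t) t := fun t => hasDerivAt_fderiv_frameLevel_transCurve μ K (hud t) (hud' t) wv
  have hpos : ∀ t ∈ Icc x y, 0 < G'' t := fun t ht => hc.trans_le (hconv t ht)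
  have hmono : StrictMonoOn G' (Icc x y) :=
    strictMonoOn_of_deriv_pos (convex_Icc x y)
      (fun t _ => (hG'd t).continuousAt.continuousWithinAt)
      (fun t ht => by rw [(hG'd t).deriv]; exact hpos t (interior_subset ht))
  obtain ⟨Z, hZ, hmem⟩ := klsk_zeros_subset_pair_of_strictMonoOn_deriv hGd hmono
  refine ⟨Z, hZ, fun z hz hGz => hmem z hz ?_⟩
  show sqDispersion (u z • dir z - wv) + -K.eval (u z • dir z - wv) - ν = 0
  rw [hGz, sub_self]

omit hG in
/-- **Six zeros per caustic translate** (frame twin of `klsd_nearCaustic_zeros_card_le_six`).  `u` `2π`-periodic, `W = πρ₂/(√2 u_min) < 2π`, and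
`G″ ≥ c > 0` wherever `2p − v` is `(ρ₂ + 2S_E W)`-close to `2πm`: the zeros `z` of a period with `2p(z) − v` within `ρ₂` of `2πm` number at most six.
[cite: FeldmanSalmhoferTrubowitz1998, App. B] -/
theorem nearCaustic_zeros_card_le_six_frame (hper : Function.Periodic u (2 * π)) (wv : Fin 2 → ℝ) (m : Fin 2 → ℤ) (θ₀ : ℝ)
    {ρ₂ c : ℝ} (hc : 0 < c) (hσ : ρ₂ / (Real.sqrt 2 * B.umin) < 2)
    (hcwin : ∀ θ : ℝ, (∀ i, |2 * (u θ • dir θ) i - wv i - m i * (2 * π)| ≤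
        ρ₂ + 2 * (B.smax + κ₁ * (π * Real.sqrt 2 + 2 * B.smax) / (B.Dtmin - κ₁)) * (π * (ρ₂ / (Real.sqrt 2 * B.umin)))) →
      c ≤ fderiv ℝ (fderiv ℝ (frameLevel μ K)) (WithLp.toLp 2 (u θ • dir θ - wv)) (WithLp.toLp 2 ![VXE u θ, VYE u θ])
          (WithLp.toLp 2 ![VXE u θ, VYE u θ]) +
        fderiv ℝ (frameLevel μ K) (WithLp.toLp 2 (u θ • dir θ - wv))
          (WithLp.toLp 2 ![deriv (deriv u) θ * Real.cos θ - 2 * deriv u θ * Real.sin θ - u θ * Real.cos θ,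
            deriv (deriv u) θ * Real.sin θ + 2 * deriv u θ * Real.cos θ - u θ * Real.sin θ])) :
    ∃ Z : Finset ℝ, Z.card ≤ 6 ∧
      ∀ z ∈ Icc θ₀ (θ₀ + 2 * π), sqDispersion (u z • dir z - wv) + -K.eval (u z • dir z - wv) = ν →
        (∀ i, |2 * (u z • dir z) i - wv i - m i * (2 * π)| ≤ ρ₂) → z ∈ Z := by
  classical
  have hπ := Real.pi_pos
  have hup := B.umin_pos
  set SE := B.smax + κ₁ * (π * Real.sqrt 2 + 2 * B.smax) / (B.Dtmin - κ₁) with hSE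
  set W := π * (ρ₂ / (Real.sqrt 2 * B.umin)) with hW
  have hcurve_per : ∀ (z : ℝ) (k : ℤ), u (z + k * (2 * π)) • dir (z + k * (2 * π)) = u z • dir z := by
    intro z k
    have h1 : u (z + k * (2 * π)) = u z := hper.int_mul k z
    have h2 : dir (z + k * (2 * π)) = dir z := by
      ext i; fin_cases i
      · simp [dir, Real.cos_add_int_mul_two_pi]
      · simp [dir, Real.sin_add_int_mul_two_pi]
    rw [h1, h2]
  by_cases hex : ∃ ζ ∈ Icc θ₀ (θ₀ + 2 * π), sqDispersion (u ζ • dir ζ - wv) + -K.eval (u ζ • dir ζ - wv) = ν ∧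
      ∀ i, |2 * (u ζ • dir ζ) i - wv i - m i * (2 * π)| ≤ ρ₂
  · obtain ⟨ζ, hζP, -, hζw⟩ := hex
    have hwin : ∀ k : ℤ, ∀ θ ∈ Icc (ζ + k * (2 * π) - W) (ζ + k * (2 * π) + W),
        ∀ i, |2 * (u θ • dir θ) i - wv i - m i * (2 * π)| ≤ ρ₂ + 2 * SE * W := by
      intro k θ hθ i
      have hL := abs_curve_sub_le_frame B hδ hlo hhi hκ hκ₁ hu θ (ζ + k * (2 * π)) i
      rw [hcurve_per ζ k] at hL
      have hdist : |θ - (ζ + k * (2 * π))| ≤ W := by rw [abs_le]; constructor <;> linarith [hθ.1, hθ.2]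
      have hSE0 : 0 ≤ SE := by
        have h0 := abs_curve_sub_le_frame B hδ hlo hhi hκ hκ₁ hu (ζ + 1) ζ 0
        rw [show ζ + 1 - ζ = (1 : ℝ) by ring, abs_one, mul_one] at h0
        exact (abs_nonneg _).trans h0
      have hL' : |(u θ • dir θ) i - (u ζ • dir ζ) i| ≤ SE * W := hL.trans (mul_le_mul_of_nonneg_left hdist hSE0)
      obtain ⟨a1, a2⟩ := abs_le.1 hL'
      obtain ⟨b1, b2⟩ := abs_le.1 (hζw i)
      rw [abs_le]; constructor <;> linarith
    have hZk : ∀ k : ℤ, ∃ Z : Finset ℝ, Z.card ≤ 2 ∧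
        ∀ z ∈ Icc (ζ + k * (2 * π) - W) (ζ + k * (2 * π) + W),
          sqDispersion (u z • dir z - wv) + -K.eval (u z • dir z - wv) = ν → z ∈ Z :=
      fun k => window_zeros_card_le_two_frame B hδ hlo hhi hκ hκ₁ hu wv hc (fun t ht => hcwin t (hwin k t ht))
    choose Zk hZk_card hZk_mem using hZk
    refine ⟨Zk (-1) ∪ Zk 0 ∪ Zk 1, ?_, ?_⟩
    · calc (Zk (-1) ∪ Zk 0 ∪ Zk 1).card ≤ (Zk (-1) ∪ Zk 0).card + (Zk 1).card := Finset.card_union_le _ _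
        _ ≤ ((Zk (-1)).card + (Zk 0).card) + (Zk 1).card := by gcongr; exact Finset.card_union_le _ _
        _ ≤ (2 + 2) + 2 := by gcongr <;> exact hZk_card _
        _ = 6 := by norm_num
    · intro z hzP hGz hzw
      have hclose : ∀ i : Fin 2, |(u z • dir z) i - (u ζ • dir ζ) i| ≤ ρ₂ := by
        intro i
        obtain ⟨a1, a2⟩ := abs_le.1 (hzw i)
        obtain ⟨b1, b2⟩ := abs_le.1 (hζw i)
        rw [abs_le]; constructor <;> linarith
      obtain ⟨k, hk⟩ := exists_int_near_of_close_frame B hδ hlo hhi hu hclose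
      have hWlt : W < 2 * π := by rw [hW]; nlinarith [hσ, hπ]
      have hzζ : |z - ζ| ≤ 2 * π := by
        rw [abs_le]; constructor <;> linarith [hzP.1, hzP.2, hζP.1, hζP.2]
      have hkabs : |(k : ℝ)| < 2 := by
        have h3 : |(k : ℝ) * (2 * π)| ≤ |z - ζ| + W := by
          have e : (k : ℝ) * (2 * π) = (z - ζ) - (z - ζ - k * (2 * π)) := by ring
          calc |(k : ℝ) * (2 * π)| = |(z - ζ) - (z - ζ - k * (2 * π))| := by rw [← e]
            _ ≤ |z - ζ| + |z - ζ - k * (2 * π)| := abs_sub _ _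
            _ ≤ |z - ζ| + W := by linarith [hk]
        rw [abs_mul, abs_of_pos (by positivity : (0:ℝ) < 2 * π)] at h3
        have h4 : |(k : ℝ)| * (2 * π) < 2 * (2 * π) := by linarith
        exact lt_of_mul_lt_mul_right h4 (by positivity)
      have hk2 : -2 < k ∧ k < 2 := by
        rw [abs_lt] at hkabs
        exact ⟨by exact_mod_cast hkabs.1, by exact_mod_cast hkabs.2⟩
      have hzI : z ∈ Icc (ζ + k * (2 * π) - W) (ζ + k * (2 * π) + W) := by
        rw [abs_le] at hk; constructor <;> linarith [hk.1, hk.2]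
      have hzmem := hZk_mem k z hzI hGz
      rcases hk2 with ⟨hk1, hk3⟩
      interval_cases k
      · exact Finset.mem_union_left _ (Finset.mem_union_left _ (by simpa using hzmem))
      · exact Finset.mem_union_left _ (Finset.mem_union_right _ (by simpa using hzmem))
      · exact Finset.mem_union_right _ (by simpa using hzmem)
  · refine ⟨∅, by simp, ?_⟩
    intro z hz hGz hzw
    exact (hex ⟨z, hz, hGz, hzw⟩).elim

end Root

end Summit.HubbardSuperconductivity.HubbardSuperconductivity.Theorems.PerturbedFermiCurve

end
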